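import Mathlib
import HarnessLib
import Literature.MathematicalPhysics.StatisticalMechanics.RelevantHamiltonianNorm

/-!
# The linear operator `A_k^{(q)}` of the renormalisation step on relevant Hamiltonians and the
# bound `‖(A_k^{(q)})⁻¹‖ ≤ ¾` ([ABKM19] (6.56), Lemma 10.5)

The `H`-component of the renormalisation transformation of Adams–Buchholz–Kotecký–Müller is linear:
`H_{k+1} = A_k^{(q)} H_k + B_k^{(q)} K_k` with ((6.56), proof of Lemma 10.5)
`(A_k H)(B', φ) = Σ_{B ∈ 𝓑_k(B')} H(B, φ) + L^{(k+1)d} Σ_{(i,α),(j,β)} a_{(i,α),(j,β)} (∇^β)*∇^α 𝒞_{k+1}(0)`: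
in COEFFICIENTS (per site), `A_k` keeps the linear and quadratic coefficients and shifts the
constant one by the Gaussian expectation of the quadratic part,
`a'_∅ = a_∅ + Σ_q a_q γ_q`, `γ_q = (∇_j)*∇_i 𝒞_{k+1}(0)` ((10.37)).  Hence `A_k` is invertible with
the explicit inverse `a_∅ = a'_∅ − Σ_q a'_q γ_q`, and Lemma 10.5 bounds the inverse between the
coefficient norms `‖·‖_{k+1,0} → ‖·‖_{k,0}` by `¾`: every weight of `‖·‖_{k,0}` is at most half the
corresponding weight of `‖·‖_{k+1,0}` (`L ≥ 2`, `h_{k+1} = 2h_k`), and the shift costs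
`L^{kd} max_q|γ_q| Σ|a_q| ≤ ¼‖H'‖_{k+1,0}` once `h_{k+1}² ≥ 4 C_{2,0}` ((10.38)–(10.40)).

* `stepOpA γ H`, `stepOpAInv γ H` — `A_k^{(q)}` and its inverse on coefficient vectors
  (`γ : quadIndex d → ℝ` the second moments of the fluctuation gradient); `stepOpAInv_stepOpA`,
  `stepOpA_stepOpAInv`, additivity and homogeneity;
* **`hamNorm_stepOpAInv_le`** — Lemma 10.5 in the parameters of `hamNorm`: if the scale-`k`
  weights are at most half the scale-`(k+1)` weights and `n · |γ_q| ≤ ¼ · n'(𝔥'/R')²`, then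
  `‖A⁻¹H'‖_{k,0} ≤ ¾ ‖H'‖_{k+1,0}`.

Everything is proved; no named fact.  Not here: the identification of `γ_q` with the moments of
`μ_{k+1}` (`Π₂ R_{k+1} H(B) = A_k H`, the Gaussian computation of `R_{k+1}H`) and the verification of
the weight inequalities for the [ABKM19] parameters (`WeightParametersABKM`).

## References
* S. Adams, S. Buchholz, R. Kotecký, S. Müller, arXiv:1910.13564, Theorem 6.8 (6.56), Lemma 10.5
  and its proof (10.37)–(10.40) [AdamsBuchholzKoteckyMuller2019].
-/

noncomputable section

namespace Literature.MathematicalPhysics.StatisticalMechanics.GradientRG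

open scoped BigOperators
open Finset

variable {𝕜 : Type*} [NormedField 𝕜] [NormedAlgebra ℝ 𝕜] {d : ℕ}

/-! ## The operator and its inverse -/

/-- **`A_k^{(q)}` on coefficient vectors** ((6.56)/(10.37)): the constant coefficient is shifted by
`Σ_q a_q γ_q`, the other coefficients are unchanged. [cite: AdamsBuchholzKoteckyMuller2019, Theorem 6.8 (6.56)] -/
def stepOpA (γ : quadIndex d → ℝ) (H : RelevantHamiltonian 𝕜 d) : RelevantHamiltonian 𝕜 d := fun ι =>
  match ι with
  | Sum.inl _ => H (Sum.inl ()) + ∑ q : quadIndex d, (γ q : ℝ) • H (Sum.inr (Sum.inr q))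
  | Sum.inr (Sum.inl α) => H (Sum.inr (Sum.inl α))
  | Sum.inr (Sum.inr q) => H (Sum.inr (Sum.inr q))

/-- **The inverse of `A_k^{(q)}`**: `a_∅ = a'_∅ − Σ_q a'_q γ_q`.
[cite: AdamsBuchholzKoteckyMuller2019, Lemma 10.5 (proof: "Thus A is invertible")] -/
def stepOpAInv (γ : quadIndex d → ℝ) (H : RelevantHamiltonian 𝕜 d) : RelevantHamiltonian 𝕜 d := fun ι =>
  match ι with
  | Sum.inl _ => H (Sum.inl ()) - ∑ q : quadIndex d, (γ q : ℝ) • H (Sum.inr (Sum.inr q))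
  | Sum.inr (Sum.inl α) => H (Sum.inr (Sum.inl α))
  | Sum.inr (Sum.inr q) => H (Sum.inr (Sum.inr q))

/-- The constant coefficient of `A H`. [cite: AdamsBuchholzKoteckyMuller2019, Lemma 10.5 (10.37)] -/
@[simp] theorem stepOpA_const (γ : quadIndex d → ℝ) (H : RelevantHamiltonian 𝕜 d) (u : Unit) :
    stepOpA γ H (Sum.inl u) = H (Sum.inl ()) + ∑ q : quadIndex d, (γ q : ℝ) • H (Sum.inr (Sum.inr q)) := rfl

/-- The linear coefficients of `A H`. [cite: AdamsBuchholzKoteckyMuller2019, Lemma 10.5 (10.37)] -/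
@[simp] theorem stepOpA_lin (γ : quadIndex d → ℝ) (H : RelevantHamiltonian 𝕜 d) (α : linIndex d) :
    stepOpA γ H (Sum.inr (Sum.inl α)) = H (Sum.inr (Sum.inl α)) := rfl

/-- The quadratic coefficients of `A H`. [cite: AdamsBuchholzKoteckyMuller2019, Lemma 10.5 (10.37)] -/
@[simp] theorem stepOpA_quad (γ : quadIndex d → ℝ) (H : RelevantHamiltonian 𝕜 d) (q : quadIndex d) :
    stepOpA γ H (Sum.inr (Sum.inr q)) = H (Sum.inr (Sum.inr q)) := rfl

/-- The constant coefficient of `A⁻¹ H`. [cite: AdamsBuchholzKoteckyMuller2019, Lemma 10.5] -/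
@[simp] theorem stepOpAInv_const (γ : quadIndex d → ℝ) (H : RelevantHamiltonian 𝕜 d) (u : Unit) :
    stepOpAInv γ H (Sum.inl u) = H (Sum.inl ()) - ∑ q : quadIndex d, (γ q : ℝ) • H (Sum.inr (Sum.inr q)) := rfl

/-- The linear coefficients of `A⁻¹ H`. [cite: AdamsBuchholzKoteckyMuller2019, Lemma 10.5] -/
@[simp] theorem stepOpAInv_lin (γ : quadIndex d → ℝ) (H : RelevantHamiltonian 𝕜 d) (α : linIndex d) :
    stepOpAInv γ H (Sum.inr (Sum.inl α)) = H (Sum.inr (Sum.inl α)) := rfl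

/-- The quadratic coefficients of `A⁻¹ H`. [cite: AdamsBuchholzKoteckyMuller2019, Lemma 10.5] -/
@[simp] theorem stepOpAInv_quad (γ : quadIndex d → ℝ) (H : RelevantHamiltonian 𝕜 d) (q : quadIndex d) :
    stepOpAInv γ H (Sum.inr (Sum.inr q)) = H (Sum.inr (Sum.inr q)) := rfl

/-- **`A⁻¹ ∘ A = id`.** [cite: AdamsBuchholzKoteckyMuller2019, Lemma 10.5 (proof)] -/
theorem stepOpAInv_stepOpA (γ : quadIndex d → ℝ) (H : RelevantHamiltonian 𝕜 d) :
    stepOpAInv γ (stepOpA γ H) = H := by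
  funext ι
  rcases ι with u | α | q
  · simp only [stepOpAInv_const, stepOpA_const, stepOpA_quad]; abel
  · rfl
  · rfl

/-- **`A ∘ A⁻¹ = id`.** [cite: AdamsBuchholzKoteckyMuller2019, Lemma 10.5 (proof)] -/
theorem stepOpA_stepOpAInv (γ : quadIndex d → ℝ) (H : RelevantHamiltonian 𝕜 d) :
    stepOpA γ (stepOpAInv γ H) = H := by
  funext ι
  rcases ι with u | α | q
  · simp only [stepOpA_const, stepOpAInv_const, stepOpAInv_quad]; abel
  · rfl
  · rfl

/-- `A` is additive. [cite: AdamsBuchholzKoteckyMuller2019, Theorem 6.8 (A_k is linear)] -/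
theorem stepOpA_add (γ : quadIndex d → ℝ) (H H' : RelevantHamiltonian 𝕜 d) :
    stepOpA γ (H + H') = stepOpA γ H + stepOpA γ H' := by
  funext ι
  rcases ι with u | α | q
  · simp only [stepOpA_const, Pi.add_apply, smul_add, Finset.sum_add_distrib]; abel
  · rfl
  · rfl

/-- `A` is homogeneous. [cite: AdamsBuchholzKoteckyMuller2019, Theorem 6.8 (A_k is linear)] -/
theorem stepOpA_smul (γ : quadIndex d → ℝ) (c : 𝕜) (H : RelevantHamiltonian 𝕜 d) :
    stepOpA γ (c • H) = c • stepOpA γ H := by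
  funext ι
  rcases ι with u | α | q
  · simp only [stepOpA_const, Pi.smul_apply, smul_eq_mul, mul_add, Finset.mul_sum, mul_smul_comm]
  · rfl
  · rfl

/-! ## Lemma 10.5: `‖A⁻¹‖ ≤ ¾` -/

/-- The norm of a real multiple in a normed `ℝ`-algebra: `‖r • a‖ = |r| ‖a‖`. [folklore] -/
private theorem norm_real_smul (r : ℝ) (a : 𝕜) : ‖(r • a : 𝕜)‖ = |r| * ‖a‖ := by
  rw [norm_smul, Real.norm_eq_abs]

/-- **Lemma 10.5** in the parameters of the coefficient norm `hamNorm 𝔥 R n` (scale `k`: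
`(𝔥, R, n) = (h_k L^{−k(d−2)/2}, L^k, L^{kd})`): if every weight at scale `k` is at most half the
corresponding weight at scale `k+1` (`n ≤ ½n'`, `n 𝔥 R^{−|α|} ≤ ½ n' 𝔥' R'^{−|α|}`,
`n(𝔥/R)² ≤ ½ n'(𝔥'/R')²` — for [ABKM19]'s parameters: `L ≥ 2`, `h_{k+1} = 2h_k`) and the shift is
small, `n · |γ_q| ≤ ¼ · n'(𝔥'/R')²` for all `q` ((10.39): `|γ_q| ≤ C_{2,0}L^{−kd}` and
`h_{k+1}² ≥ 4C_{2,0}`), then `‖A⁻¹ H'‖_{k,0} ≤ ¾ ‖H'‖_{k+1,0}`.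
[cite: AdamsBuchholzKoteckyMuller2019, Lemma 10.5] -/
theorem hamNorm_stepOpAInv_le {𝔥 R 𝔥' R' : ℝ} {n n' : ℕ} (h𝔥' : 0 ≤ 𝔥') (hR' : 0 ≤ R')
    (hc : (n : ℝ) ≤ (1 / 2 : ℝ) * n')
    (hl : ∀ α : linIndex d, (n : ℝ) * (𝔥 * (R ^ (∑ i, (α : Fin d → ℕ) i))⁻¹) ≤
      (1 / 2 : ℝ) * (n' * (𝔥' * (R' ^ (∑ i, (α : Fin d → ℕ) i))⁻¹)))
    (hq : (n : ℝ) * (𝔥 / R) ^ 2 ≤ (1 / 2 : ℝ) * (n' * (𝔥' / R') ^ 2))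
    {γ : quadIndex d → ℝ} (hγ : ∀ q, (n : ℝ) * |γ q| ≤ (1 / 4 : ℝ) * (n' * (𝔥' / R') ^ 2))
    (H' : RelevantHamiltonian 𝕜 d) :
    hamNorm 𝔥 R n (stepOpAInv γ H') ≤ (3 / 4 : ℝ) * hamNorm 𝔥' R' n' H' := by
  have hn : (0 : ℝ) ≤ n := Nat.cast_nonneg _
  have hn' : (0 : ℝ) ≤ n' := Nat.cast_nonneg _
  set c₀ : ℝ := ‖H' (Sum.inl ())‖ with hc₀
  set cl : linIndex d → ℝ := fun α => ‖H' (Sum.inr (Sum.inl α))‖ with hcl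
  set cq : quadIndex d → ℝ := fun q => ‖H' (Sum.inr (Sum.inr q))‖ with hcq
  have hc₀0 : 0 ≤ c₀ := norm_nonneg _
  have hcl0 : ∀ α, 0 ≤ cl α := fun α => norm_nonneg _
  have hcq0 : ∀ q, 0 ≤ cq q := fun q => norm_nonneg _
  -- the constant coefficient of `A⁻¹H'`
  have hshift : ‖stepOpAInv γ H' (Sum.inl ())‖ ≤ c₀ + ∑ q, |γ q| * cq q := by
    rw [stepOpAInv_const]
    refine (norm_sub_le _ _).trans (add_le_add le_rfl ?_)
    refine (norm_sum_le _ _).trans (Finset.sum_le_sum fun q _ => ?_)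
    rw [norm_real_smul]
  -- the three blocks at scale `k`
  have t0 : (n : ℝ) * ‖stepOpAInv γ H' (Sum.inl ())‖ ≤
      (1 / 2 : ℝ) * (n' * c₀) + (1 / 4 : ℝ) * (n' * (𝔥' / R') ^ 2) * ∑ q, cq q := by
    calc (n : ℝ) * ‖stepOpAInv γ H' (Sum.inl ())‖ ≤ n * (c₀ + ∑ q, |γ q| * cq q) :=
          mul_le_mul_of_nonneg_left hshift hn
      _ = n * c₀ + ∑ q, (n * |γ q|) * cq q := by rw [mul_add, Finset.mul_sum]; simp only [mul_assoc]
      _ ≤ (1 / 2 : ℝ) * n' * c₀ + ∑ q, ((1 / 4 : ℝ) * (n' * (𝔥' / R') ^ 2)) * cq q := by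
          refine add_le_add ?_ (Finset.sum_le_sum fun q _ => ?_)
          · have := mul_le_mul_of_nonneg_right hc hc₀0; linarith
          · exact mul_le_mul_of_nonneg_right (hγ q) (hcq0 q)
      _ = (1 / 2 : ℝ) * (n' * c₀) + (1 / 4 : ℝ) * (n' * (𝔥' / R') ^ 2) * ∑ q, cq q := by
          rw [← Finset.mul_sum]; ring
  have t1 : (n : ℝ) * ∑ α : linIndex d, 𝔥 * (R ^ (∑ i, (α : Fin d → ℕ) i))⁻¹ * cl α ≤
      (1 / 2 : ℝ) * (n' * ∑ α : linIndex d, 𝔥' * (R' ^ (∑ i, (α : Fin d → ℕ) i))⁻¹ * cl α) := by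
    rw [Finset.mul_sum, Finset.mul_sum, Finset.mul_sum]
    refine Finset.sum_le_sum fun α _ => ?_
    have := mul_le_mul_of_nonneg_right (hl α) (hcl0 α)
    calc (n : ℝ) * (𝔥 * (R ^ (∑ i, (α : Fin d → ℕ) i))⁻¹ * cl α)
        = (n : ℝ) * (𝔥 * (R ^ (∑ i, (α : Fin d → ℕ) i))⁻¹) * cl α := by ring
      _ ≤ (1 / 2 : ℝ) * (n' * (𝔥' * (R' ^ (∑ i, (α : Fin d → ℕ) i))⁻¹)) * cl α := this
      _ = (1 / 2 : ℝ) * (n' * (𝔥' * (R' ^ (∑ i, (α : Fin d → ℕ) i))⁻¹ * cl α)) := by ring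
  have t2 : (n : ℝ) * ∑ q, (𝔥 / R) ^ 2 * cq q ≤ (1 / 2 : ℝ) * (n' * ∑ q, (𝔥' / R') ^ 2 * cq q) := by
    rw [Finset.mul_sum, Finset.mul_sum, Finset.mul_sum]
    refine Finset.sum_le_sum fun q _ => ?_
    have := mul_le_mul_of_nonneg_right hq (hcq0 q)
    calc (n : ℝ) * ((𝔥 / R) ^ 2 * cq q) = (n : ℝ) * (𝔥 / R) ^ 2 * cq q := by ring
      _ ≤ (1 / 2 : ℝ) * (n' * (𝔥' / R') ^ 2) * cq q := this
      _ = (1 / 2 : ℝ) * (n' * ((𝔥' / R') ^ 2 * cq q)) := by ring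
  have hsumq : (1 / 4 : ℝ) * (n' * (𝔥' / R') ^ 2) * ∑ q, cq q =
      (1 / 4 : ℝ) * (n' * ∑ q, (𝔥' / R') ^ 2 * cq q) := by
    rw [← Finset.mul_sum]; ring
  -- non-negativity of the scale-`(k+1)` blocks
  have hpos_c : 0 ≤ (n' : ℝ) * c₀ := mul_nonneg hn' hc₀0
  have hpos_l : 0 ≤ (n' : ℝ) * ∑ α : linIndex d, 𝔥' * (R' ^ (∑ i, (α : Fin d → ℕ) i))⁻¹ * cl α :=
    mul_nonneg hn' (Finset.sum_nonneg fun α _ =>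
      mul_nonneg (mul_nonneg h𝔥' (inv_nonneg.2 (pow_nonneg hR' _))) (hcl0 α))
  have hpos_q : 0 ≤ (n' : ℝ) * ∑ q, (𝔥' / R') ^ 2 * cq q :=
    mul_nonneg hn' (Finset.sum_nonneg fun q _ => mul_nonneg (sq_nonneg _) (hcq0 q))
  -- assemble
  unfold hamNorm
  simp only [stepOpAInv_lin, stepOpAInv_quad]
  have lhs : (n : ℝ) * (‖stepOpAInv γ H' (Sum.inl ())‖ +
      ∑ α : linIndex d, 𝔥 * (R ^ (∑ i, (α : Fin d → ℕ) i))⁻¹ * cl α + ∑ q, (𝔥 / R) ^ 2 * cq q) =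
      (n : ℝ) * ‖stepOpAInv γ H' (Sum.inl ())‖ + (n : ℝ) * ∑ α : linIndex d, 𝔥 * (R ^ (∑ i, (α : Fin d → ℕ) i))⁻¹ * cl α
        + (n : ℝ) * ∑ q, (𝔥 / R) ^ 2 * cq q := by ring
  rw [lhs]
  have rhs : (3 / 4 : ℝ) * ((n' : ℝ) * (c₀ + ∑ α : linIndex d, 𝔥' * (R' ^ (∑ i, (α : Fin d → ℕ) i))⁻¹ * cl α +
      ∑ q, (𝔥' / R') ^ 2 * cq q)) =
      (3 / 4 : ℝ) * ((n' : ℝ) * c₀) + (3 / 4 : ℝ) * ((n' : ℝ) * ∑ α : linIndex d, 𝔥' * (R' ^ (∑ i, (α : Fin d → ℕ) i))⁻¹ * cl α)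
        + (3 / 4 : ℝ) * ((n' : ℝ) * ∑ q, (𝔥' / R') ^ 2 * cq q) := by ring
  rw [rhs]
  linarith [t0, t1, t2, hsumq, hpos_c, hpos_l, hpos_q]

end Literature.MathematicalPhysics.StatisticalMechanics.GradientRG

end
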